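import Mathlib.Algebra.Lie.Sl2
import Mathlib.LinearAlgebra.Eigenspace.Basic
import Mathlib.LinearAlgebra.FiniteDimensional.Lemmas
import Mathlib.Tactic.Module
import Literature.Algebra.Lie.Sl2ModuleWeights   -- ★ complete reducibility `IsSl2Triple.exists_isCompl_of_forall_lie_mem`
import HarnessLib

/-!
# The explicit `𝔰𝔩₂`-string module `V(n) ⊗ W` on `Fin (n+1) → W` and the bound on its highest weight vectors

[topic Algebra/Lie]

Topic `Literature/Algebra/Lie`; namespace `Literature.Algebra.Lie`.  Four DEFINITIONS with bodies (`strGet`, `strE`, `strF`, `strH`) and theorems;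
no named fact, no instance, no notation, no `sorry`.  Written for cell `hodgecm-mathlib` (F0∕P3, T1a arch line, road «V19 in-house for `U(2,1)`»,
node N3d; seat A-p14 (g23), LEAD F0P3b-p01 (g2)), but the content is elementary `𝔰𝔩₂`-algebra.

THE MATHEMATICS ([Humphreys1972, §7.2 Lemma and formulas (a)–(c)]; [Bourbaki2008LieGroups79, Ch. VIII §1 no. 2–3]; [FultonHarris1991, §11.1]).
Let `W` be a vector space over a field `k` of characteristic `0` with three endomorphisms `e_W, f_W, h_W` (in the application an
`𝔰𝔩₂`-triple, but §1–§2 need NO relation among them), and `n ∈ ℕ`.  On `S := Fin (n+1) → W = ⊕_{j=0}^{n} W` ("`V(n) ⊗ W` in the basis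
`v_0, …, v_n` of the standard string with `e v_j = j v_{j−1}`, `f v_j = (n−j) v_{j+1}`, `h v_j = (n−2j) v_j`") put
* `(e_S w)_j = e_W w_j + (j+1) w_{j+1}`, `(f_S w)_j = f_W w_j + (n−j+1) w_{j−1}`, `(h_S w)_j = h_W w_j + (n−2j) w_j` (out-of-range components read
  as `0`; §1, stated uniformly through the `ℕ`-indexed reader `strGet`);
* §2 THE BOUND: a vector `w ∈ S` with `e_S w = 0` and `h_S w = μ w` is determined by its top component `w_0`, which satisfies `h_W w_0 = (μ − n) w_0`
  (downward recursion `w_{j+1} = −(j+1)⁻¹ e_W w_j`); hence **`dim (ker e_S ∩ S_μ) ≤ dim W_{μ−n}`** (`W_ν` the `ν`-eigenspace of `h_W`) — the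
  highest weight vectors of weight `μ` in `V(n) ⊗ W` are at most as many as the weight-`(μ−n)` vectors of `W`, and there are none unless
  `μ − n` is an `h_W`-eigenvalue ("the highest weights of `V(n) ⊗ W` are among the `n + ν`, `ν` a weight of `W`", [Humphreys1972, §24 Ex. 9]);
* §3 if `(h_W, e_W, f_W)` satisfy the `𝔰𝔩₂` relations then so do `(h_S, e_S, f_S)` (the tensor product representation);
* §4 then `S` is completely reducible (the tree's H. Weyl theorem ★ `IsSl2Triple.exists_isCompl_of_forall_lie_mem`), whence THE BOUND FOR IMAGES:
  for any linear `Ψ : S → M'` intertwining `(e_S,f_S,h_S)` with endomorphisms `(e',f',h')` of `M'`,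
  **`dim (ker e' ∩ M'_μ ∩ Ψ(S)) ≤ dim W_{μ−n}`** (`finrank_weightVectors_range_le`).

HONEST LABEL: pure linear algebra; nothing about HC_CM is discharged here.  HC_CM is proved only modulo the 2 remaining named inputs (hLiu418, h413)
until rung 0 closes.

## References
* J. E. Humphreys, *Introduction to Lie Algebras and Representation Theory*, GTM 9 (1972), §7.2, §22.5 Ex. 7, §24 Ex. 9. [Humphreys1972]
* N. Bourbaki, *Lie Groups and Lie Algebras, Chapters 7–9* (2008), Ch. VIII §1 no. 2–3. [Bourbaki2008LieGroups79]
* W. Fulton, J. Harris, *Representation Theory. A First Course*, GTM 129 (1991), §11.1. [FultonHarris1991]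
-/

set_option autoImplicit false

noncomputable section

namespace Literature.Algebra.Lie

open Module

variable {k : Type*} [Field k] {W : Type*} [AddCommGroup W] [Module k W]

/-! ## §0 The `ℕ`-indexed component reader -/

/-- **`strGet n w m := w_m`** for `m ≤ n` and `0` for `m > n` (the components of `w ∈ ⊕_{j=0}^n W`, read on all of `ℕ`). [cite: Humphreys1972, §7.2] -/
def strGet (n : ℕ) (w : Fin (n + 1) → W) (m : ℕ) : W := if h : m < n + 1 then w ⟨m, h⟩ else 0

/-- `strGet n w m = w ⟨m, _⟩` in range. [cite: Humphreys1972, §7.2] -/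
theorem strGet_of_lt (n : ℕ) (w : Fin (n + 1) → W) {m : ℕ} (h : m < n + 1) : strGet n w m = w ⟨m, h⟩ := by
  rw [strGet, dif_pos h]

/-- `strGet n w j = w j` at a `Fin` index. [cite: Humphreys1972, §7.2] -/
theorem strGet_fin (n : ℕ) (w : Fin (n + 1) → W) (j : Fin (n + 1)) : strGet n w j = w j := by
  rw [strGet_of_lt n w j.2]

/-- `strGet n w m = 0` out of range. [cite: Humphreys1972, §7.2] -/
theorem strGet_of_le (n : ℕ) (w : Fin (n + 1) → W) {m : ℕ} (h : n + 1 ≤ m) : strGet n w m = 0 := by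
  rw [strGet, dif_neg (by omega)]

/-- Two vectors with the same components are equal. [cite: Humphreys1972, §7.2] -/
theorem strGet_ext (n : ℕ) {w w' : Fin (n + 1) → W} (h : ∀ m : ℕ, strGet n w m = strGet n w' m) : w = w' := by
  funext j
  rw [← strGet_fin n w j, ← strGet_fin n w' j, h]

/-- `strGet` is additive. [cite: Humphreys1972, §7.2] -/
theorem strGet_add (n : ℕ) (w w' : Fin (n + 1) → W) (m : ℕ) : strGet n (w + w') m = strGet n w m + strGet n w' m := by
  by_cases h : m < n + 1
  · simp only [strGet_of_lt n _ h, Pi.add_apply]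
  · simp only [strGet_of_le n _ (not_lt.mp h), add_zero]

/-- `strGet` is homogeneous. [cite: Humphreys1972, §7.2] -/
theorem strGet_smul (n : ℕ) (c : k) (w : Fin (n + 1) → W) (m : ℕ) : strGet n (c • w) m = c • strGet n w m := by
  by_cases h : m < n + 1
  · simp only [strGet_of_lt n _ h, Pi.smul_apply]
  · simp only [strGet_of_le n _ (not_lt.mp h), smul_zero]

/-- `strGet n 0 m = 0`. [cite: Humphreys1972, §7.2] -/
theorem strGet_zero (n m : ℕ) : strGet n (0 : Fin (n + 1) → W) m = 0 := by
  by_cases h : m < n + 1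
  · simp only [strGet_of_lt n _ h, Pi.zero_apply]
  · simp only [strGet_of_le n _ (not_lt.mp h)]

/-- The reader as a linear map in `w`. [cite: Humphreys1972, §7.2] -/
theorem strGet_sub (n : ℕ) (w w' : Fin (n + 1) → W) (m : ℕ) : strGet n (w - w') m = strGet n w m - strGet n w' m := by
  by_cases h : m < n + 1
  · simp only [strGet_of_lt n _ h, Pi.sub_apply]
  · simp only [strGet_of_le n _ (not_lt.mp h), sub_zero]

/-! ## §1 The operators `e_S`, `f_S`, `h_S` on `S = Fin (n+1) → W` -/

/-- **`(e_S w)_j := e_W w_j + (j+1) w_{j+1}`** (`w_{n+1} := 0`): `e ⊗ 1 + 1 ⊗ e` on `V(n) ⊗ W` in the basis `e v_j = j v_{j−1}`.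
[cite: Humphreys1972, §7.2 Lemma (b)] -/
def strE (eW : Module.End k W) (n : ℕ) : Module.End k (Fin (n + 1) → W) where
  toFun w j := eW (w j) + (((j : ℕ) : k) + 1) • strGet n w (j + 1)
  map_add' w w' := by
    funext j
    simp only [Pi.add_apply, map_add, strGet_add, smul_add]
    abel
  map_smul' c w := by
    funext j
    simp only [Pi.smul_apply, map_smul, strGet_smul, RingHom.id_apply, smul_add, smul_comm c]

/-- **`(f_S w)_j := f_W w_j + (n−j+1) w_{j−1}`** (`w_{−1} := 0`): `f ⊗ 1 + 1 ⊗ f` on `V(n) ⊗ W` in the basis `f v_j = (n−j) v_{j+1}`.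
[cite: Humphreys1972, §7.2 Lemma (c)] -/
def strF (fW : Module.End k W) (n : ℕ) : Module.End k (Fin (n + 1) → W) where
  toFun w j := fW (w j) + (if (j : ℕ) = 0 then (0 : W) else (((n : k) + 1 - j) • strGet n w (j - 1)))
  map_add' w w' := by
    funext j
    simp only [Pi.add_apply, map_add, strGet_add, smul_add]
    split_ifs <;> abel
  map_smul' c w := by
    funext j
    simp only [Pi.smul_apply, map_smul, strGet_smul, RingHom.id_apply, smul_add]
    split_ifs
    · simp
    · rw [smul_comm c]

/-- **`(h_S w)_j := h_W w_j + (n − 2j) w_j`**: `h ⊗ 1 + 1 ⊗ h` on `V(n) ⊗ W` (`h v_j = (n−2j) v_j`). [cite: Humphreys1972, §7.2 Lemma (a)] -/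
def strH (hW : Module.End k W) (n : ℕ) : Module.End k (Fin (n + 1) → W) where
  toFun w j := hW (w j) + ((n : k) - 2 * j) • w j
  map_add' w w' := by
    funext j
    simp only [Pi.add_apply, map_add, smul_add]
    abel
  map_smul' c w := by
    funext j
    simp only [Pi.smul_apply, map_smul, RingHom.id_apply, smul_add, smul_comm c]

variable (eW fW hW : Module.End k W) (n : ℕ)

/-- Component formula, `Fin` form: `(e_S w)_j = e_W w_j + (j+1) w_{j+1}`. [cite: Humphreys1972, §7.2 Lemma (b)] -/
theorem strE_apply (w : Fin (n + 1) → W) (j : Fin (n + 1)) : strE eW n w j = eW (w j) + (((j : ℕ) : k) + 1) • strGet n w (j + 1) := rfl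

/-- Component formula, `Fin` form: `(f_S w)_j = f_W w_j + (n−j+1) w_{j−1}`. [cite: Humphreys1972, §7.2 Lemma (c)] -/
theorem strF_apply (w : Fin (n + 1) → W) (j : Fin (n + 1)) :
    strF fW n w j = fW (w j) + (if (j : ℕ) = 0 then (0 : W) else (((n : k) + 1 - j) • strGet n w (j - 1))) := rfl

/-- Component formula, `Fin` form: `(h_S w)_j = h_W w_j + (n−2j) w_j`. [cite: Humphreys1972, §7.2 Lemma (a)] -/
theorem strH_apply (w : Fin (n + 1) → W) (j : Fin (n + 1)) : strH hW n w j = hW (w j) + ((n : k) - 2 * j) • w j := rfl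

/-- **`(e_S w)_m = e_W w_m + (m+1) w_{m+1}` for every `m ∈ ℕ`** (both sides vanish for `m > n`). [cite: Humphreys1972, §7.2 Lemma (b)] -/
theorem strGet_strE (w : Fin (n + 1) → W) (m : ℕ) :
    strGet n (strE eW n w) m = eW (strGet n w m) + ((m : k) + 1) • strGet n w (m + 1) := by
  by_cases h : m < n + 1
  · rw [strGet_of_lt n _ h, strE_apply, strGet_of_lt n _ h]
  · rw [strGet_of_le n _ (not_lt.mp h), strGet_of_le n _ (not_lt.mp h), strGet_of_le n _ (by omega), map_zero, smul_zero, add_zero]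

/-- **`(f_S w)_0 = f_W w_0`.** [cite: Humphreys1972, §7.2 Lemma (c)] -/
theorem strGet_strF_zero (w : Fin (n + 1) → W) : strGet n (strF fW n w) 0 = fW (strGet n w 0) := by
  rw [strGet_of_lt n _ (Nat.succ_pos n), strF_apply, strGet_of_lt n _ (Nat.succ_pos n)]
  simp

/-- **`(f_S w)_{m+1} = f_W w_{m+1} + (n − m) w_m` for every `m ∈ ℕ`.** [cite: Humphreys1972, §7.2 Lemma (c)] -/
theorem strGet_strF_succ (w : Fin (n + 1) → W) (m : ℕ) :
    strGet n (strF fW n w) (m + 1) = fW (strGet n w (m + 1)) + ((n : k) - m) • strGet n w m := by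
  by_cases h : m + 1 < n + 1
  · rw [strGet_of_lt n _ h, strF_apply, strGet_of_lt n w h]
    simp only [Nat.add_eq_zero_iff, one_ne_zero, and_false, ↓reduceIte, Nat.add_sub_cancel, Nat.cast_add, Nat.cast_one]
    congr 2
    ring
  · rw [strGet_of_le n _ (not_lt.mp h), strGet_of_le n _ (not_lt.mp h), map_zero, zero_add]
    rcases Nat.eq_or_lt_of_le (show n ≤ m by omega) with rfl | hlt
    · simp
    · rw [strGet_of_le n _ (by omega), smul_zero]

/-- **`(h_S w)_m = h_W w_m + (n − 2m) w_m` for every `m ∈ ℕ`.** [cite: Humphreys1972, §7.2 Lemma (a)] -/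
theorem strGet_strH (w : Fin (n + 1) → W) (m : ℕ) :
    strGet n (strH hW n w) m = hW (strGet n w m) + ((n : k) - 2 * m) • strGet n w m := by
  by_cases h : m < n + 1
  · rw [strGet_of_lt n _ h, strH_apply, strGet_of_lt n _ h]
  · rw [strGet_of_le n _ (not_lt.mp h), strGet_of_le n _ (not_lt.mp h), map_zero, smul_zero, add_zero]

/-! ## §2 Highest weight vectors of `S` are determined by their top component -/

/-- **Downward recursion**: if `e_S w = 0` then `(m+1) w_{m+1} = −e_W w_m`. [cite: Humphreys1972, §7.2 (proof of the Theorem)] -/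
theorem strGet_succ_eq_of_strE_eq_zero {w : Fin (n + 1) → W} (hw : strE eW n w = 0) (m : ℕ) :
    ((m : k) + 1) • strGet n w (m + 1) = -eW (strGet n w m) := by
  have h := strGet_strE eW n w m
  rw [hw, strGet_zero] at h
  exact (neg_eq_of_add_eq_zero_right h.symm).symm ▸ (eq_neg_of_add_eq_zero_right h.symm)

/-- **A vector killed by `e_S` with vanishing top component vanishes** (characteristic `0`). [cite: Humphreys1972, §7.2 (proof of the Theorem)] -/
theorem eq_zero_of_strE_eq_zero_of_apply_zero [CharZero k] {w : Fin (n + 1) → W} (hw : strE eW n w = 0) (h0 : strGet n w 0 = 0) :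
    w = 0 := by
  have key : ∀ m : ℕ, strGet n w m = 0 := by
    intro m
    induction m with
    | zero => exact h0
    | succ m ih =>
      have h := strGet_succ_eq_of_strE_eq_zero eW n hw m
      rw [ih, map_zero, neg_zero] at h
      exact (smul_eq_zero.mp h).resolve_left (Nat.cast_add_one_ne_zero m)
  exact strGet_ext n fun m => by rw [key, strGet_zero]

/-- The top component of an `h_S`-eigenvector of eigenvalue `μ` is an `h_W`-eigenvector of eigenvalue `μ − n`. [cite: Humphreys1972, §7.2 Lemma (a)] -/
theorem strGet_zero_mem_eigenspace_of_mem_eigenspace {μ : k} {w : Fin (n + 1) → W} (hw : w ∈ Module.End.eigenspace (strH hW n) μ) :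
    strGet n w 0 ∈ Module.End.eigenspace hW (μ - n) := by
  rw [Module.End.mem_eigenspace_iff] at hw ⊢
  have h := strGet_strH hW n w 0
  rw [hw, strGet_smul, Nat.cast_zero, mul_zero, sub_zero] at h
  rw [sub_smul]
  exact (eq_sub_of_add_eq h.symm)

/-- **THE BOUND: `dim (ker e_S ∩ S_μ) ≤ dim W_{μ−n}`** — the highest weight vectors of weight `μ` of `V(n) ⊗ W` inject, by `w ↦ w_0`, into the
`(μ − n)`-eigenspace of `h_W`; in particular there are none unless `μ − n` is an `h_W`-eigenvalue.
[cite: Humphreys1972, §7.2 Theorem, §24 Ex. 9] [cite: Bourbaki2008LieGroups79, Ch. VIII §1 no. 3 Prop. 4] -/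
theorem finrank_ker_strE_inf_eigenspace_le [CharZero k] [FiniteDimensional k W] (μ : k) :
    finrank k ↥(LinearMap.ker (strE eW n) ⊓ Module.End.eigenspace (strH hW n) μ) ≤ finrank k ↥(Module.End.eigenspace hW (μ - n)) := by
  -- the top-component map
  let π : ↥(LinearMap.ker (strE eW n) ⊓ Module.End.eigenspace (strH hW n) μ) →ₗ[k] ↥(Module.End.eigenspace hW (μ - n)) :=
    { toFun := fun w => ⟨strGet n (w : Fin (n + 1) → W) 0, strGet_zero_mem_eigenspace_of_mem_eigenspace hW n w.2.2⟩
      map_add' := fun w w' => by ext; simp [strGet_add]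
      map_smul' := fun c w => by ext; simp [strGet_smul] }
  refine LinearMap.finrank_le_finrank_of_injective (f := π) fun w w' hww' => ?_
  have h0 : strGet n ((w : Fin (n + 1) → W) - (w' : Fin (n + 1) → W)) 0 = 0 := by
    rw [strGet_sub, sub_eq_zero]
    exact congrArg Subtype.val hww'
  have hker : strE eW n ((w : Fin (n + 1) → W) - (w' : Fin (n + 1) → W)) = 0 := by
    rw [map_sub, LinearMap.mem_ker.mp w.2.1, LinearMap.mem_ker.mp w'.2.1, sub_zero]
  exact Subtype.ext (sub_eq_zero.mp (eq_zero_of_strE_eq_zero_of_apply_zero eW n hker h0))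

/-! ## §3 The `𝔰𝔩₂` relations transfer from `W` to `S` -/

/-- **`[e_S, f_S] = h_S`** if `[e_W, f_W] = h_W`. [cite: Humphreys1972, §7.2 Lemma] [cite: FultonHarris1991, §11.1] -/
theorem strE_mul_strF_sub (hrel : eW * fW - fW * eW = hW) : strE eW n * strF fW n - strF fW n * strE eW n = strH hW n := by
  refine LinearMap.ext fun w => strGet_ext n fun m => ?_
  rw [LinearMap.sub_apply, strGet_sub, Module.End.mul_apply, Module.End.mul_apply, strGet_strH, ← hrel, LinearMap.sub_apply,
    Module.End.mul_apply, Module.End.mul_apply]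
  rcases m with _ | m
  · rw [strGet_strE, strGet_strF_zero, strGet_strF_succ, strGet_strF_zero, strGet_strE]
    simp only [map_add, map_smul, Nat.cast_zero]
    module
  · rw [strGet_strE, strGet_strF_succ, strGet_strF_succ, strGet_strF_succ, strGet_strE, strGet_strE]
    simp only [map_add, map_smul]
    push_cast
    module

/-- **`[h_S, e_S] = 2 e_S`** if `[h_W, e_W] = 2 e_W`. [cite: Humphreys1972, §7.2 Lemma] [cite: FultonHarris1991, §11.1] -/
theorem strH_mul_strE_sub (hrel : hW * eW - eW * hW = (2 : k) • eW) : strH hW n * strE eW n - strE eW n * strH hW n = (2 : k) • strE eW n := by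
  refine LinearMap.ext fun w => strGet_ext n fun m => ?_
  have hrel' : ∀ x : W, hW (eW x) = eW (hW x) + (2 : k) • eW x := fun x => by
    have := congrArg (fun T : Module.End k W => T x) hrel
    simpa [sub_eq_iff_eq_add'] using this
  rw [LinearMap.sub_apply, strGet_sub, Module.End.mul_apply, Module.End.mul_apply, LinearMap.smul_apply, strGet_smul, strGet_strH, strGet_strE,
    strGet_strE, strGet_strH, strGet_strH]
  simp only [map_add, map_smul, hrel']
  push_cast
  module

/-- **`[h_S, f_S] = −2 f_S`** if `[h_W, f_W] = −2 f_W`. [cite: Humphreys1972, §7.2 Lemma] [cite: FultonHarris1991, §11.1] -/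
theorem strH_mul_strF_sub (hrel : hW * fW - fW * hW = -((2 : k) • fW)) :
    strH hW n * strF fW n - strF fW n * strH hW n = -((2 : k) • strF fW n) := by
  refine LinearMap.ext fun w => strGet_ext n fun m => ?_
  have hrel' : ∀ x : W, hW (fW x) = fW (hW x) - (2 : k) • fW x := fun x => by
    have := congrArg (fun T : Module.End k W => T x) hrel
    simpa [sub_eq_iff_eq_add', ← sub_eq_add_neg] using this
  rw [LinearMap.sub_apply, strGet_sub, Module.End.mul_apply, Module.End.mul_apply, LinearMap.neg_apply, LinearMap.smul_apply, ← neg_smul,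
    strGet_smul, strGet_strH]
  rcases m with _ | m
  · rw [strGet_strF_zero, strGet_strF_zero, strGet_strH]
    simp only [map_add, map_smul, hrel', Nat.cast_zero]
    module
  · rw [strGet_strF_succ, strGet_strF_succ, strGet_strH, strGet_strH]
    simp only [map_add, map_smul, hrel']
    push_cast
    module

/-- `e_S` raises `h_S`-weights by `2` (from `[h_S, e_S] = 2 e_S`). [cite: Humphreys1972, §7.2 Lemma] -/
theorem strE_apply_mem_eigenspace (hrel : hW * eW - eW * hW = (2 : k) • eW) {μ : k} {w : Fin (n + 1) → W}
    (hw : w ∈ Module.End.eigenspace (strH hW n) μ) : strE eW n w ∈ Module.End.eigenspace (strH hW n) (μ + 2) := by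
  rw [Module.End.mem_eigenspace_iff] at hw ⊢
  have h := congrArg (fun T : Module.End k (Fin (n + 1) → W) => T w) (strH_mul_strE_sub eW hW n hrel)
  simp only [LinearMap.sub_apply, Module.End.mul_apply, LinearMap.smul_apply, hw, map_smul] at h
  rw [add_smul]
  exact sub_eq_iff_eq_add'.mp h

/-- `f_S` lowers `h_S`-weights by `2` (from `[h_S, f_S] = −2 f_S`). [cite: Humphreys1972, §7.2 Lemma] -/
theorem strF_apply_mem_eigenspace (hrel : hW * fW - fW * hW = -((2 : k) • fW)) {μ : k} {w : Fin (n + 1) → W}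
    (hw : w ∈ Module.End.eigenspace (strH hW n) μ) : strF fW n w ∈ Module.End.eigenspace (strH hW n) (μ - 2) := by
  rw [Module.End.mem_eigenspace_iff] at hw ⊢
  have h := congrArg (fun T : Module.End k (Fin (n + 1) → W) => T w) (strH_mul_strF_sub fW hW n hrel)
  simp only [LinearMap.sub_apply, Module.End.mul_apply, LinearMap.neg_apply, LinearMap.smul_apply, hw, map_smul] at h
  rw [sub_smul, sub_eq_iff_eq_add'.mp h, ← sub_eq_add_neg]

/-- The single-component vector `j ↦ [j = m] x` has components `strGet = [· = m] x`. [cite: Humphreys1972, §7.2] -/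
theorem strGet_single (m : Fin (n + 1)) (x : W) (m' : ℕ) : strGet n (Pi.single m x) m' = if m' = (m : ℕ) then x else 0 := by
  by_cases h : m' < n + 1
  · rw [strGet_of_lt n _ h]
    by_cases hm : m' = (m : ℕ)
    · subst hm
      simp
    · rw [if_neg hm, Pi.single_apply, if_neg (fun h' => hm (by rw [← h']))]
  · rw [strGet_of_le n _ (not_lt.mp h), if_neg (by omega)]

/-- **Weight vectors**: `h_S (δ_m ⊗ x) = (ν + n − 2m) (δ_m ⊗ x)` for `h_W x = ν x` — the vector `x ∈ W_ν` placed in component `m` is an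
`h_S`-eigenvector of eigenvalue `ν + (n − 2m)`. [cite: Humphreys1972, §7.2 Lemma (a)] [cite: FultonHarris1991, §11.1] -/
theorem single_mem_eigenspace_strH {ν : k} {x : W} (hx : x ∈ Module.End.eigenspace hW ν) (m : Fin (n + 1)) :
    (Pi.single m x : Fin (n + 1) → W) ∈ Module.End.eigenspace (strH hW n) (ν + ((n : k) - 2 * m)) := by
  rw [Module.End.mem_eigenspace_iff] at hx ⊢
  funext j
  rw [strH_apply, Pi.smul_apply, Pi.single_apply]
  split_ifs with hj
  · subst hj
    rw [hx, add_smul]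
  · simp

/-! ## §4 Complete reducibility of `S` and the bound for equivariant images of `S` -/

section CompleteReducibility

-- Mathlib idiom (as in Mathlib's `Algebra.Lie.OfAssociative` and the tree's `Sl2ModuleWeights`): the commutator bracket on `Module.End k S`,
-- needed to speak of an `IsSl2Triple` of endomorphisms (`LieRing.ofAssociativeRing` is a `def` in Mathlib, not a global instance).
attribute [local instance 100] LieRing.ofAssociativeRing

variable [CharZero k] [FiniteDimensional k W]

omit [FiniteDimensional k W] in
/-- If `h_S = 0` then `e_S = 0` (from `[h_S, e_S] = 2 e_S`, characteristic `0`). [cite: Humphreys1972, §7.2 Lemma] -/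
theorem strE_eq_zero_of_strH_eq_zero (hhe : hW * eW - eW * hW = (2 : k) • eW) (h0 : strH hW n = 0) : strE eW n = 0 := by
  have h := strH_mul_strE_sub eW hW n hhe
  rw [h0, zero_mul, mul_zero, sub_zero] at h
  exact (smul_eq_zero.mp h.symm).resolve_left two_ne_zero

omit [FiniteDimensional k W] in
/-- If `h_S = 0` then `f_S = 0` (from `[h_S, f_S] = −2 f_S`, characteristic `0`). [cite: Humphreys1972, §7.2 Lemma] -/
theorem strF_eq_zero_of_strH_eq_zero (hhf : hW * fW - fW * hW = -((2 : k) • fW)) (h0 : strH hW n = 0) : strF fW n = 0 := by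
  have h := strH_mul_strF_sub fW hW n hhf
  rw [h0, zero_mul, mul_zero, sub_zero, eq_comm, neg_eq_zero] at h
  exact (smul_eq_zero.mp h).resolve_left two_ne_zero

/-- **Complete reducibility of `S = V(n) ⊗ W`**: every subspace of `S` stable under `e_S` and `f_S` has a supplement stable under `e_S` and
`f_S` — the tree's H. Weyl theorem for `𝔰𝔩₂` (★ `IsSl2Triple.exists_isCompl_of_forall_lie_mem`) applied to the triple `(h_S, e_S, f_S)` of
endomorphisms of `S` (when `h_S = 0` all three vanish and any supplement will do).
[cite: Bourbaki2008LieGroups79, Ch. VIII §1 no. 2 Cor. of Prop. 2] [cite: Humphreys1972, §6.3 Theorem (Weyl), §7.2] -/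
theorem str_exists_isCompl (hef : eW * fW - fW * eW = hW) (hhe : hW * eW - eW * hW = (2 : k) • eW)
    (hhf : hW * fW - fW * hW = -((2 : k) • fW)) {N : Submodule k (Fin (n + 1) → W)}
    (heN : ∀ m ∈ N, strE eW n m ∈ N) (hfN : ∀ m ∈ N, strF fW n m ∈ N) :
    ∃ N' : Submodule k (Fin (n + 1) → W), IsCompl N N' ∧ (∀ m ∈ N', strE eW n m ∈ N') ∧ ∀ m ∈ N', strF fW n m ∈ N' := by
  by_cases h0 : strH hW n = 0
  · obtain ⟨N', hN'⟩ := Submodule.exists_isCompl N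
    refine ⟨N', hN', fun m hm => ?_, fun m hm => ?_⟩
    · rw [strE_eq_zero_of_strH_eq_zero eW hW n hhe h0, LinearMap.zero_apply]; exact N'.zero_mem
    · rw [strF_eq_zero_of_strH_eq_zero fW hW n hhf h0, LinearMap.zero_apply]; exact N'.zero_mem
  · have t : IsSl2Triple (strH hW n) (strE eW n) (strF fW n) :=
      { h_ne_zero := h0
        lie_e_f := by rw [LieRing.of_associative_ring_bracket, strE_mul_strF_sub eW fW hW n hef]
        lie_h_e_nsmul := by rw [LieRing.of_associative_ring_bracket, strH_mul_strE_sub eW hW n hhe, two_smul, two_nsmul]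
        lie_h_f_nsmul := by rw [LieRing.of_associative_ring_bracket, strH_mul_strF_sub fW hW n hhf, two_smul, two_nsmul] }
    obtain ⟨N', hN', heN', hfN'⟩ := Literature.Algebra.Lie.IsSl2Triple.exists_isCompl_of_forall_lie_mem (k := k) t (N := N)
      (fun m hm => by simpa using heN m hm) (fun m hm => by simpa using hfN m hm)
    exact ⟨N', hN', fun m hm => by simpa using heN' m hm, fun m hm => by simpa using hfN' m hm⟩

/-- **THE BOUND FOR EQUIVARIANT IMAGES: if `Ψ : S → M'` intertwines `(e_S, f_S, h_S)` with `(e', f', h')` then the `e'`-killed `h'`-eigenvectors of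
eigenvalue `μ` inside `Ψ(S)` are at most `dim W_{μ−n}` in number** — a stable supplement `C` of `ker Ψ` maps isomorphically onto `Ψ(S)`, and
the preimage in `C` of such a vector is an `e_S`-killed `h_S`-eigenvector (§2).
[cite: Humphreys1972, §7.2 Theorem] [cite: Bourbaki2008LieGroups79, Ch. VIII §1 no. 2 Cor. of Prop. 2, no. 3 Prop. 4] -/
theorem finrank_weightVectors_range_le (hef : eW * fW - fW * eW = hW) (hhe : hW * eW - eW * hW = (2 : k) • eW)
    (hhf : hW * fW - fW * hW = -((2 : k) • fW)) {M' : Type*} [AddCommGroup M'] [Module k M'] (Ψ : (Fin (n + 1) → W) →ₗ[k] M')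
    (e' f' h' : Module.End k M') (hΨe : ∀ w, Ψ (strE eW n w) = e' (Ψ w)) (hΨf : ∀ w, Ψ (strF fW n w) = f' (Ψ w))
    (hΨh : ∀ w, Ψ (strH hW n w) = h' (Ψ w)) (μ : k) :
    finrank k ↥(LinearMap.ker e' ⊓ Module.End.eigenspace h' μ ⊓ LinearMap.range Ψ) ≤ finrank k ↥(Module.End.eigenspace hW (μ - n)) := by
  -- a stable supplement `C` of `ker Ψ`
  have hkere : ∀ m ∈ LinearMap.ker Ψ, strE eW n m ∈ LinearMap.ker Ψ := fun m hm => by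
    rw [LinearMap.mem_ker] at hm ⊢; rw [hΨe, hm, map_zero]
  have hkerf : ∀ m ∈ LinearMap.ker Ψ, strF fW n m ∈ LinearMap.ker Ψ := fun m hm => by
    rw [LinearMap.mem_ker] at hm ⊢; rw [hΨf, hm, map_zero]
  obtain ⟨C, hC, hCe, hCf⟩ := str_exists_isCompl eW fW hW n hef hhe hhf hkere hkerf
  have hCh : ∀ m ∈ C, strH hW n m ∈ C := fun m hm => by
    rw [← strE_mul_strF_sub eW fW hW n hef, LinearMap.sub_apply, Module.End.mul_apply, Module.End.mul_apply]
    exact C.sub_mem (hCe _ (hCf m hm)) (hCf _ (hCe m hm))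
  -- every `x ∈ range Ψ` has a unique preimage in `C`
  have hsur : ∀ x ∈ LinearMap.range Ψ, ∃ c ∈ C, Ψ c = x := by
    rintro _ ⟨s, rfl⟩
    obtain ⟨a, ha, c, hc, rfl⟩ := Submodule.mem_sup.mp (show s ∈ LinearMap.ker Ψ ⊔ C by rw [hC.sup_eq_top]; trivial)
    exact ⟨c, hc, by rw [map_add, LinearMap.mem_ker.mp ha, zero_add]⟩
  have hinj : ∀ c ∈ C, Ψ c = 0 → c = 0 := fun c hc h0 =>
    (Submodule.mem_bot k).mp (hC.inf_eq_bot ▸ Submodule.mem_inf.mpr ⟨LinearMap.mem_ker.mpr h0, hc⟩)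
  choose! lift hliftC hliftΨ using hsur
  -- the lift of a weight vector is a weight vector
  have hmem : ∀ x : ↥(LinearMap.ker e' ⊓ Module.End.eigenspace h' μ ⊓ LinearMap.range Ψ),
      lift x ∈ LinearMap.ker (strE eW n) ⊓ Module.End.eigenspace (strH hW n) μ := by
    intro x
    obtain ⟨⟨hxe, hxh⟩, hxr⟩ := x.2
    refine ⟨LinearMap.mem_ker.mpr (hinj _ (hCe _ (hliftC x hxr)) ?_), Module.End.mem_eigenspace_iff.mpr ?_⟩
    · rw [hΨe, hliftΨ x hxr]; exact LinearMap.mem_ker.mp hxe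
    · rw [← sub_eq_zero]
      refine hinj _ (C.sub_mem (hCh _ (hliftC x hxr)) (C.smul_mem μ (hliftC x hxr))) ?_
      rw [map_sub, map_smul, hΨh, hliftΨ x hxr, sub_eq_zero]
      exact Module.End.mem_eigenspace_iff.mp hxh
  -- the lifting map is linear and injective
  let φ : ↥(LinearMap.ker e' ⊓ Module.End.eigenspace h' μ ⊓ LinearMap.range Ψ) →ₗ[k]
      ↥(LinearMap.ker (strE eW n) ⊓ Module.End.eigenspace (strH hW n) μ) :=
    { toFun := fun x => ⟨lift x, hmem x⟩
      map_add' := fun x y => by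
        ext1
        change lift ((x : M') + y) = lift x + lift y
        refine sub_eq_zero.mp (hinj _ (C.sub_mem (hliftC _ (x + y).2.2) (C.add_mem (hliftC _ x.2.2) (hliftC _ y.2.2))) ?_)
        rw [map_sub, map_add, hliftΨ _ x.2.2, hliftΨ _ y.2.2]
        have hxy := hliftΨ _ (x + y).2.2
        rw [Submodule.coe_add] at hxy
        rw [hxy, sub_self]
      map_smul' := fun c x => by
        ext1
        change lift (c • (x : M')) = c • lift x
        refine sub_eq_zero.mp (hinj _ (C.sub_mem (hliftC _ (c • x).2.2) (C.smul_mem c (hliftC _ x.2.2))) ?_)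
        rw [map_sub, map_smul, hliftΨ _ x.2.2]
        have hcx := hliftΨ _ (c • x).2.2
        rw [Submodule.coe_smul] at hcx
        rw [hcx, sub_self] }
  have hφ : Function.Injective φ := by
    intro x y hxy
    have h := congrArg (fun z : ↥(LinearMap.ker (strE eW n) ⊓ Module.End.eigenspace (strH hW n) μ) => Ψ (z : Fin (n + 1) → W)) hxy
    simp only [φ, LinearMap.coe_mk, AddHom.coe_mk, hliftΨ _ x.2.2, hliftΨ _ y.2.2] at h
    exact Subtype.ext h
  exact (LinearMap.finrank_le_finrank_of_injective hφ).trans (finrank_ker_strE_inf_eigenspace_le eW hW n μ)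

end CompleteReducibility

end Literature.Algebra.Lie

end
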